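import Summits.NavierStokesRegularity.NavierStokesRegularity.Theorems.ScenarioCensusRowA8HonestGauge

/-!
# Screw Oseen gauge — part 2/4: O5 Galilean boosts, time shifts, O3b′ Galilean-defect period, period algebra

Part 2 of the four-file re-homing of ns-idea-3's `ScenarioCensusScrewGauge.lean` (sha16 27b7018076f2c110); overview and
provenance in part 1 (`ScenarioCensusRowA8HonestGauge.lean`).  Contents (verbatim): §3e O5 `galileanBoost_holds` /
`IsGenuine.boost_core` via the tree's drift-mild Galilean covariance on constant-drift windows; §3f time shifts
`IsGenuine.time_shift`, `isGenuine_iff_shift_zero`, boosts on `(−∞,T)` and THE LEVER O3b′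
`galileanDefectPeriod_holds`; §3g the period algebra and the chord lemmas feeding the seam (part 3).
No census value changes; NS regularity is NOT proved; no summit statement is proved by this file.
-/

noncomputable section

open MeasureTheory Set Filter Topology Function Metric
open scoped ENNReal NNReal

set_option linter.dupNamespace false

namespace Summit.NavierStokesRegularity.NavierStokesRegularity.Theorems.ScenarioCensus.RowA8HonestCell

open Literature.Analysis Literature.Analysis.FluidPDE Literature.Analysis.UnboundedOperators
open Summit.NavierStokesRegularity.NavierStokesRegularity.Theorems.ScenarioCensus (Row_A8)
open Summit.NavierStokesRegularity.NavierStokesRegularity.Theorems.ScenarioCensus.PitchDefect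
  (helical_transfer twist_eq_twist_of_tendsto tendsto_setAverage_sub_of_oseenMild)

/-! ## §3e  O5 is a theorem (Galilean boosts of the honest class) — the tree's drift-mild Galilean
covariance `IsKNSSDriftMild.galileanCovariance_R3` (drift `b` ↦ zero drift in the co-moving frame) applied to
the CONSTANT-drift pair `(v − k, k)` on windows, read back through `driftDuhamel_zero_eq_oseenDuhamel`,
`IsKNSSDriftMild.eq_heatExtension_sub_oseenDuhamel_three`, time translation (`oseenDuhamel_timeShift`) and
space translation (`oseenDuhamel_comp_add_right`, `heatExtension_comp_add_right_apply`). -/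

/-- Time translation of the Oseen–Duhamel term (two uses of the tree's `oseenDuhamel_timeShift`). -/
theorem oseenDuhamel_time_translate (ν s t c : ℝ) (f g : ℝ → E3 → E3) (x : E3) :
    oseenDuhamel ν (s + c) (fun τ => f (τ - c)) (fun τ => g (τ - c)) (t + c) x =
      oseenDuhamel ν s f g t x := by
  have h1 : oseenDuhamel ν (s + c) (fun τ => f (τ - c)) (fun τ => g (τ - c)) (t + c) x =
      oseenDuhamel ν 0 (fun ρ => f (ρ + s)) (fun ρ => g (ρ + s)) (t + c - (s + c)) x := by
    have h := oseenDuhamel_timeShift ν (s + c) (fun ρ => f (ρ + s)) (fun ρ => g (ρ + s)) (t + c) x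
    have ef : (fun τ => f (τ - c)) = fun τ => (fun ρ => f (ρ + s)) (τ - (s + c)) := by
      funext τ; simp only; congr 1; ring
    have eg : (fun τ => g (τ - c)) = fun τ => (fun ρ => g (ρ + s)) (τ - (s + c)) := by
      funext τ; simp only; congr 1; ring
    rw [ef, eg]
    exact h
  have h2 : oseenDuhamel ν s f g t x =
      oseenDuhamel ν 0 (fun ρ => f (ρ + s)) (fun ρ => g (ρ + s)) (t - s) x := by
    have h := oseenDuhamel_timeShift ν s (fun ρ => f (ρ + s)) (fun ρ => g (ρ + s)) t x
    have ef : (fun τ => (fun ρ => f (ρ + s)) (τ - s)) = f := by funext τ; simp only [sub_add_cancel]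
    have eg : (fun τ => (fun ρ => g (ρ + s)) (τ - s)) = g := by funext τ; simp only [sub_add_cancel]
    rw [ef, eg] at h
    exact h
  rw [h1, h2, show t + c - (s + c) = t - s by ring]

/-- Weak divergence-freeness is invariant under `y ↦ f (y + a) − c`. -/
theorem isWeaklyDivFree_shift_sub {f : E3 → E3} (hf : IsWeaklyDivFree f) (a c : E3) :
    IsWeaklyDivFree fun y => f (y + a) - c := by
  have h := (hf.comp_add_right' a).add_const (-c)
  have e : (fun y => f (y + a) - c) = fun y => f (y + a) + -c := by
    funext y; rw [sub_eq_add_neg]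
  exact (congrArg IsWeaklyDivFree e).mpr h

set_option maxHeartbeats 800000 in
/-- **The constant-drift window pair.** For `v` honest on `(−∞,0)`, `k ∈ ℝ³` and `L > 0`, the pair
`U t' y := v (t' − L) y − k`, `b ≡ k` is drift-mild on the window `(0, L)` (its drift tensor is that of the
zero-drift field `v (· − L)`, so the drift-mild identity is `v`'s Oseen identity shifted in time). -/
theorem IsGenuine.driftMild_window {v : ℝ → E3 → E3} (hv : IsGenuine 0 v) (k : E3) {L : ℝ}
    (_hL : 0 < L) : ∃ N : ℝ, IsKNSSDriftMild L N (fun t' y => v (t' - L) y - k) (fun _ => k) := by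
  have hv' := hv
  obtain ⟨hm, hc, ⟨K, hK⟩, hdiv, hmild⟩ := hv
  have hK0 : 0 ≤ K := (norm_nonneg _).trans (hK (-1) (by norm_num) 0)
  have hE : Module.finrank ℝ E3 = 3 := finrank_euclideanSpace_fin
  refine ⟨K + ‖k‖, ?_, fun _ => by linarith [norm_nonneg k], ?_, fun t' ht' x => ?_, ?_,
    fun s' t' hs' hst' ht'L x => ?_⟩
  · exact measurable_const
  · have e : uncurry (fun t' y => v (t' - L) y - k) =
        (fun z : E3 => z - k) ∘ uncurry v ∘ fun p : ℝ × E3 => (p.1 - L, p.2) := by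
      funext p; rfl
    rw [e]
    exact (measurable_sub_const k).comp (hm.comp ((measurable_fst.sub_const L).prodMk measurable_snd))
  · have ht'0 : t' - L < 0 := by linarith [ht'.2]
    have h1 : ‖v (t' - L) x - k‖ ≤ ‖v (t' - L) x‖ + ‖k‖ := norm_sub_le (v (t' - L) x) k
    have h2 : ‖v (t' - L) x‖ ≤ K := hK (t' - L) ht'0 x
    show ‖v (t' - L) x - k‖ ≤ K + ‖k‖
    linarith
  · refine (ae_restrict_iff' measurableSet_Ioo).2 (Eventually.of_forall fun t' ht' => ?_)
    have ht'0 : t' - L < 0 := by linarith [ht'.2]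
    have h := isWeaklyDivFree_shift_sub (hdiv (t' - L) ht'0) 0 k
    have e : (fun y => v (t' - L) (y + 0) - k) = fun y => v (t' - L) y - k := by
      funext y; rw [add_zero]
    exact (congrArg IsWeaklyDivFree e).mp h
  · have hs'0 : s' - L < t' - L := by linarith
    have ht'0 : t' - L < 0 := by linarith
    have hvst := hmild (s' - L) (t' - L) hs'0 ht'0 x
    -- the caloric term
    have hheat : heatExtension (fun y => v (s' - L) y - k) (t' - s') x =
        heatExtension (v (s' - L)) (t' - s') x + -k := by
      have hsl : Continuous (v (s' - L)) := hv'.continuous_slice (by linarith)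
      have h := heatExtension_add_const_apply hsl.aestronglyMeasurable (C := K)
        (fun y => hK _ (by linarith) y) (-k) (sub_pos.2 hst') x
      have e : (fun y => v (s' - L) y - k) = fun y => v (s' - L) y + -k := by
        funext y; rw [sub_eq_add_neg]
      rw [e]
      exact h
    -- the Duhamel term: the drift tensor of `(U, k)` is that of the zero-drift field `v (· − L)`
    have hT : driftTensor (fun t' y => v (t' - L) y - k) (fun _ => k) =
        driftTensor (fun σ y => v (σ - L) y) 0 := by
      funext σ i j y
      simp only [driftTensor, sub_add_cancel, Pi.zero_apply, add_zero]
    have hVm : ∀ σ ∈ Ioo s' t', Measurable (fun y => v (σ - L) y) := fun σ _ =>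
      hm.comp (measurable_const.prodMk measurable_id)
    have hVN : ∀ σ ∈ Ioo s' t', ∀ y, ‖v (σ - L) y‖ ≤ K := fun σ hσ y =>
      hK _ (by linarith [hσ.2]) y
    have hduh : driftDuhamel (fun t' y => v (t' - L) y - k) (fun _ => k) s' t' x =
        oseenDuhamel 1 (s' - L) v v (t' - L) x := by
      rw [driftDuhamel_apply, hT, ← driftDuhamel_apply,
        driftDuhamel_zero_eq_oseenDuhamel hE hVm hVN hst'.le x]
      have h := oseenDuhamel_time_translate 1 (s' - L) (t' - L) L v v x
      simp only [sub_add_cancel] at h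
      exact h
    rw [hheat, hduh, hvst, show t' - L - (s' - L) = t' - s' by ring]
    abel

/-- The co-moving field of the window pair, evaluated: `galileanShift U k (τ + L) y = v τ (y + L•k + τ•k) − k`. -/
theorem galileanShift_window_apply (v : ℝ → E3 → E3) (k : E3) (L τ : ℝ) (y : E3) :
    galileanShift (fun t' y => v (t' - L) y - k) (fun _ => k) (τ + L) y = v τ (y + L • k + τ • k) - k := by
  have e1 : driftPath (fun _ : ℝ => k) (τ + L) = (τ + L) • k := by
    simp [driftPath, intervalIntegral.integral_const]
  rw [galileanShift_apply, e1]
  show v (τ + L - L) (y + (τ + L) • k) - k = v τ (y + L • k + τ • k) - k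
  rw [add_sub_cancel_right, add_smul, show y + (τ • k + L • k) = y + L • k + τ • k by abel]

set_option maxHeartbeats 800000 in
/-- **The core boost**: `v` honest on `(−∞,0)` ⇒ `(τ, y) ↦ v τ (y + τ•k) − k` honest on `(−∞,0)`: the tree's
Galilean covariance `IsKNSSDriftMild.galileanCovariance_R3` applied to the constant-drift window pair, read in
Oseen form (`eq_heatExtension_sub_oseenDuhamel_three`), then the time shift `L` and the space shift `L•k` undone. -/
theorem IsGenuine.boost_core {v : ℝ → E3 → E3} (hv : IsGenuine 0 v) (k : E3) :
    IsGenuine 0 fun τ y => v τ (y + τ • k) - k := by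
  have hv' := hv
  obtain ⟨hm, hc, ⟨K, hK⟩, hdiv, hmild⟩ := hv
  refine ⟨?_, ?_, ⟨K + ‖k‖, fun t ht x => ?_⟩, fun t ht => isWeaklyDivFree_shift_sub (hdiv t ht) _ _, ?_⟩
  · have e : uncurry (fun τ y => v τ (y + τ • k) - k) =
        (fun z : E3 => z - k) ∘ uncurry v ∘ fun p : ℝ × E3 => (p.1, p.2 + p.1 • k) := by
      funext p; rfl
    rw [e]
    exact (measurable_sub_const k).comp
      (hm.comp (measurable_fst.prodMk (measurable_snd.add (measurable_fst.smul_const k))))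
  · have e : uncurry (fun τ y => v τ (y + τ • k) - k) =
        (fun z : E3 => z - k) ∘ uncurry v ∘ fun p : ℝ × E3 => (p.1, p.2 + p.1 • k) := by
      funext p; rfl
    rw [e]
    refine (continuous_sub_right k).comp_continuousOn ?_
    exact hc.comp (continuous_fst.prodMk (continuous_snd.add (continuous_fst.smul continuous_const))).continuousOn
      fun p hp => ⟨hp.1, mem_univ _⟩
  · have h1 : ‖v t (x + t • k) - k‖ ≤ ‖v t (x + t • k)‖ + ‖k‖ := norm_sub_le (v t (x + t • k)) k
    have h2 : ‖v t (x + t • k)‖ ≤ K := hK t ht (x + t • k)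
    show ‖v t (x + t • k) - k‖ ≤ K + ‖k‖
    linarith
  · intro s t hst ht0 z
    -- the window `(0, L)`, `L = 1 − s`
    obtain ⟨L, hL⟩ : ∃ L : ℝ, L = 1 - s := ⟨_, rfl⟩
    have hLpos : 0 < L := by rw [hL]; linarith
    obtain ⟨N, hD⟩ := hv'.driftMild_window k hLpos
    -- Galilean covariance (tree) and the Oseen form of the co-moving field on the window
    have hG := IsKNSSDriftMild.galileanCovariance_R3 hD
    have hwin := (hG.eq_heatExtension_sub_oseenDuhamel_three (s := s + L) (t := t + L)
      (by rw [hL]; linarith) (by linarith) (by linarith)).1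
    obtain ⟨G, hGdef⟩ : ∃ G : ℝ → E3 → E3,
        G = galileanShift (fun t' y => v (t' - L) y - k) (fun _ => k) := ⟨_, rfl⟩
    rw [← hGdef] at hwin
    -- the boosted field is `G` shifted back: `v τ (y + τ•k) − k = G (τ + L) (y − L•k)`
    obtain ⟨Gs, hGs⟩ : ∃ Gs : ℝ → E3 → E3, Gs = fun τ w => G (τ + L) w := ⟨_, rfl⟩
    have hWG : ∀ τ y', v τ (y' + τ • k) - k = Gs τ (y' + -(L • k)) := by
      intro τ y'
      rw [hGs, hGdef]
      show v τ (y' + τ • k) - k = galileanShift (fun t' y => v (t' - L) y - k) (fun _ => k) (τ + L) (y' + -(L • k))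
      rw [galileanShift_window_apply, show y' + -(L • k) + L • k + τ • k = y' + τ • k by abel]
    show v t (z + t • k) - k = heatExtension (fun y => v s (y + s • k) - k) (t - s) z -
      oseenDuhamel 1 s (fun τ y => v τ (y + τ • k) - k) (fun τ y => v τ (y + τ • k) - k) t z
    simp only [hWG]
    rw [oseenDuhamel_comp_add_right, heatExtension_comp_add_right_apply]
    -- undo the time shift
    have hti : oseenDuhamel 1 s Gs Gs t (z + -(L • k)) =
        oseenDuhamel 1 (s + L) G G (t + L) (z + -(L • k)) := by
      have h := oseenDuhamel_time_translate 1 s t L Gs Gs (z + -(L • k))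
      have e : (fun τ => Gs (τ - L)) = G := by
        funext τ; rw [hGs]; simp only [sub_add_cancel]
      rw [e] at h
      exact h.symm
    rw [hti, hGs]
    show G (t + L) (z + -(L • k)) = heatExtension (G (s + L)) (t - s) (z + -(L • k)) -
      oseenDuhamel 1 (s + L) G G (t + L) (z + -(L • k))
    rw [hwin (z + -(L • k)), show t + L - (s + L) = t - s by ring]

/-- **O5 is a theorem.** -/
theorem galileanBoost_holds : GalileanBoost := by
  intro v α k hv
  have h := (hv.boost_core (-k)).comp_add_right (-α)
  have e : (fun τ y => v τ (y - α - τ • k) + k) = fun τ y => v τ (y + -α + τ • -k) - -k := by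
    funext τ y
    simp only [smul_neg, sub_eq_add_neg, neg_neg]
  exact (congrArg (IsGenuine 0) e).mpr h

/-! ## §3f  O3b′ is a theorem: time shifts, boosts on `(−∞,T)`, and the Galilean-defect period -/

/-- Time translation of the honest class: `v` genuine on `(−∞,T)` ⇒ `v (· + c)` genuine on `(−∞,T−c)`. -/
theorem IsGenuine.time_shift {T : ℝ} {v : ℝ → E3 → E3} (hv : IsGenuine T v) (c : ℝ) :
    IsGenuine (T - c) fun τ y => v (τ + c) y := by
  obtain ⟨hm, hc, ⟨K, hK⟩, hdiv, hmild⟩ := hv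
  refine ⟨?_, ?_, ⟨K, fun t ht x => hK (t + c) (by linarith) x⟩, fun t ht => hdiv (t + c) (by linarith), ?_⟩
  · have e : uncurry (fun τ y => v (τ + c) y) = uncurry v ∘ fun p : ℝ × E3 => (p.1 + c, p.2) := by
      funext p; rfl
    rw [e]
    exact hm.comp ((measurable_fst.add_const c).prodMk measurable_snd)
  · have e : uncurry (fun τ y => v (τ + c) y) = uncurry v ∘ fun p : ℝ × E3 => (p.1 + c, p.2) := by
      funext p; rfl
    rw [e]
    refine hc.comp ((continuous_fst.add continuous_const).prodMk continuous_snd).continuousOn ?_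
    intro p hp
    have h1 : p.1 < T - c := hp.1
    exact ⟨show p.1 + c < T by linarith, mem_univ _⟩
  · intro s t hst htT x
    have h := hmild (s + c) (t + c) (by linarith) (by linarith) x
    have hti : oseenDuhamel 1 s (fun τ y => v (τ + c) y) (fun τ y => v (τ + c) y) t x =
        oseenDuhamel 1 (s + c) v v (t + c) x := by
      have h2 := oseenDuhamel_time_translate 1 s t c (fun τ y => v (τ + c) y) (fun τ y => v (τ + c) y) x
      simp only [sub_add_cancel] at h2
      exact h2.symm
    show v (t + c) x = heatExtension (v (s + c)) (t - s) x -
      oseenDuhamel 1 s (fun τ y => v (τ + c) y) (fun τ y => v (τ + c) y) t x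
    rw [hti, h, show t + c - (s + c) = t - s by ring]

/-- `IsGenuine T v ↔ IsGenuine 0 (v (· + T))` (the critic's P1 lemma: the `T`-free cell equals its `T = 0` form). -/
theorem isGenuine_iff_shift_zero {T : ℝ} {v : ℝ → E3 → E3} :
    IsGenuine T v ↔ IsGenuine 0 fun τ y => v (τ + T) y := by
  constructor
  · intro hv
    have h := hv.time_shift T
    rwa [sub_self] at h
  · intro h0
    have h := h0.time_shift (-T)
    have e : (fun τ y => (fun τ y => v (τ + T) y) (τ + -T) y) = v := by
      funext τ y; simp only [neg_add_cancel_right]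
    rw [e, show (0 : ℝ) - -T = T by ring] at h
    exact h

/-- Honest Galilean boosts on `(−∞,T)` (O5 transported by the time shift). -/
theorem IsGenuine.boost {T : ℝ} {v : ℝ → E3 → E3} (hv : IsGenuine T v) (α k : E3) :
    IsGenuine T fun τ y => v τ (y - α - τ • k) + k := by
  have h0 : IsGenuine 0 fun τ y => v (τ + T) y := isGenuine_iff_shift_zero.1 hv
  have h1 := galileanBoost_holds _ (α + T • k) k h0
  have h2 := h1.time_shift (-T)
  have e : (fun τ y => v τ (y - α - τ • k) + k) =
      fun τ y => (fun τ y => (fun τ y => v (τ + T) y) τ (y - (α + T • k) - τ • k) + k) (τ + -T) y := by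
    funext τ y
    show v τ (y - α - τ • k) + k = v (τ + -T + T) (y - (α + T • k) - (τ + -T) • k) + k
    rw [neg_add_cancel_right, add_smul, neg_smul]
    congr 2
    abel
  rw [show (0 : ℝ) - -T = T by ring] at h2
  exact (congrArg (IsGenuine T) e).mpr h2

/-- **O3b′ is a theorem**: the Galilean defect is a period (honest boost matching `W` at `τ₁`, then the
tree's forward uniqueness of bounded Oseen-mild fields `FluidPDE.oseenMild_bounded_unique`). -/
theorem galileanDefectPeriod_holds : GalileanDefectPeriod := by
  intro T v ε k hv hW τ₁ τ₂ h12 h2T y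
  obtain ⟨W, hW, hWv⟩ := hW
  have h1T : τ₁ < T := h12.trans h2T
  -- the honest boost `V` of `v` that matches `W` at time `τ₁`
  obtain ⟨α, hα⟩ : ∃ α : E3, α = -ε τ₁ - τ₁ • k := ⟨_, rfl⟩
  obtain ⟨V, hVdef⟩ : ∃ V : ℝ → E3 → E3, V = fun τ y => v τ (y - α - τ • k) + k := ⟨_, rfl⟩
  have hV : IsGenuine T V := by rw [hVdef]; exact hv.boost α k
  have hVW : V τ₁ = W τ₁ := by
    funext y'
    rw [hVdef, hWv τ₁ h1T y']
    show v τ₁ (y' - α - τ₁ • k) + k = v τ₁ (y' + ε τ₁) + k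
    rw [hα, show y' - (-ε τ₁ - τ₁ • k) - τ₁ • k = y' + ε τ₁ by abel]
  -- forward uniqueness on the window `(τ₁, T)`
  have hW' := hW
  have hV' := hV
  obtain ⟨hWm, -, ⟨KW, hKW⟩, -, hWmild⟩ := hW
  obtain ⟨hVm, -, ⟨KV, hKV⟩, -, hVmild⟩ := hV
  have hM0 : 0 ≤ max (max KW KV) 0 := le_max_right _ _
  have huniq := oseenMild_bounded_unique (u := W) (v := V) (s := τ₁) (T := T)
    (U := fun t x => heatExtension (W τ₁) (t - τ₁) x) one_pos hM0
    hWm.aestronglyMeasurable hVm.aestronglyMeasurable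
    (fun t ht x => (hKW t ht.2 x).trans ((le_max_left _ _).trans (le_max_left _ _)))
    (fun t ht x => (hKV t ht.2 x).trans ((le_max_right _ _).trans (le_max_left _ _)))
    (fun t ht => Eventually.of_forall fun x => hWmild τ₁ t ht.1 ht.2 x)
    (fun t ht => Eventually.of_forall fun x => by
      have h := hVmild τ₁ t ht.1 ht.2 x
      rw [hVW] at h
      exact h)
  have hae : W τ₂ =ᵐ[volume] V τ₂ := huniq τ₂ ⟨h12, h2T⟩
  have heq : W τ₂ = V τ₂ :=
    (Continuous.ae_eq_iff_eq volume (hW'.continuous_slice h2T) (hV'.continuous_slice h2T)).1 hae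
  -- read off the period at the point `x = y − ε τ₁ + (τ₂ − τ₁)•k`
  obtain ⟨x, hx⟩ : ∃ x : E3, x = y - ε τ₁ + (τ₂ - τ₁) • k := ⟨_, rfl⟩
  have hpt := congr_fun heq x
  rw [hWv τ₂ h2T x, hVdef] at hpt
  have hpt' : v τ₂ (x + ε τ₂) = v τ₂ (x - α - τ₂ • k) := add_right_cancel hpt
  have e1 : y + (ε τ₂ - ε τ₁ + (τ₂ - τ₁) • k) = x + ε τ₂ := by rw [hx]; abel
  have e2 : x - α - τ₂ • k = y := by rw [hx, hα, sub_smul]; abel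
  rw [e1, hpt', e2]

/-! ## §3g  The seam from the PERIOD lemma (rev 4): chords of the period circle span the horizontal plane -/

section PeriodAlgebra

variable {f : E3 → E3} {a b : E3}

/-- The sum of two periods is a period. -/
theorem period_add (ha : ∀ y, f (y + a) = f y) (hb : ∀ y, f (y + b) = f y) :
    ∀ y, f (y + (a + b)) = f y := fun y => by
  rw [← add_assoc, hb (y + a), ha y]

/-- The negative of a period is a period. -/
theorem period_neg (ha : ∀ y, f (y + a) = f y) : ∀ y, f (y + -a) = f y := fun y => by
  have h := ha (y + -a)
  rw [neg_add_cancel_right] at h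
  exact h.symm

/-- Natural multiples of a period are periods. -/
theorem period_natMul (ha : ∀ y, f (y + a) = f y) : ∀ (n : ℕ) (y : E3), f (y + (n : ℝ) • a) = f y := by
  intro n
  induction n with
  | zero => intro y; simp
  | succ n ih =>
    intro y
    rw [Nat.cast_succ, add_smul, one_smul]
    exact period_add ih ha y

/-- Integer multiples of a period are periods. -/
theorem period_intMul (ha : ∀ y, f (y + a) = f y) : ∀ (m : ℤ) (y : E3), f (y + (m : ℝ) • a) = f y := by
  intro m
  obtain ⟨n, hn | hn⟩ := Int.eq_nat_or_neg m
  · intro y; rw [hn, Int.cast_natCast]; exact period_natMul ha n y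
  · intro y; rw [hn, Int.cast_neg, Int.cast_natCast, neg_smul]; exact period_neg (period_natMul ha n) y

end PeriodAlgebra

/-- every real is `4m + (2 − 2cos φ)`. -/
theorem exists_int_cos (r : ℝ) : ∃ (m : ℤ) (φ : ℝ), r = 4 * m + (2 - 2 * Real.cos φ) := by
  refine ⟨⌊r / 4⌋, Real.arccos (1 - (r - 4 * ⌊r / 4⌋) / 2), ?_⟩
  have h1 : (⌊r / 4⌋ : ℝ) ≤ r / 4 := Int.floor_le _
  have h2 : r / 4 < ⌊r / 4⌋ + 1 := Int.lt_floor_add_one _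
  rw [Real.cos_arccos (by linarith) (by linarith)]
  ring

/-- every real is `2m + 2 sin φ`. -/
theorem exists_int_sin (r : ℝ) : ∃ (m : ℤ) (φ : ℝ), r = 2 * m + 2 * Real.sin φ := by
  refine ⟨⌊r / 2⌋, Real.arcsin ((r - 2 * ⌊r / 2⌋) / 2), ?_⟩
  have h1 : (⌊r / 2⌋ : ℝ) ≤ r / 2 := Int.floor_le _
  have h2 : r / 2 < ⌊r / 2⌋ + 1 := Int.lt_floor_add_one _
  rw [Real.sin_arcsin (by linarith) (by linarith)]
  ring

/-- sum of opposite chords of the period circle: `(Δ − R_{−θ}Δ) + (Δ − R_{θ}Δ) = (2 − 2cos θ) Δ_h`. -/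
theorem chord_add (Δ : E3) (θ : ℝ) :
    (Δ - rotZ (-θ) Δ) + (Δ - rotZ θ Δ) = (2 - 2 * Real.cos θ) • hor Δ := by
  ext i; fin_cases i <;> simp [rotZ, hor, e3, Real.cos_neg, Real.sin_neg] <;> ring

/-- difference of opposite chords: `(Δ − R_{−θ}Δ) − (Δ − R_{θ}Δ) = (2 sin θ) R_{π/2} Δ_h`. -/
theorem chord_sub (Δ : E3) (θ : ℝ) :
    (Δ - rotZ (-θ) Δ) - (Δ - rotZ θ Δ) = (2 * Real.sin θ) • rotZ (Real.pi / 2) (hor Δ) := by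
  ext i; fin_cases i <;> simp [rotZ, hor, e3, Real.cos_neg, Real.sin_neg] <;> ring

/-- horizontal vectors are combinations of `Δ_h` and `R_{π/2} Δ_h` when `Δ_h ≠ 0`. -/
theorem exists_combo_hor {Δ d : E3} (hΔ : hor Δ ≠ 0) (hd : d 2 = 0) :
    ∃ a b : ℝ, d = a • hor Δ + b • rotZ (Real.pi / 2) (hor Δ) := by
  set p : ℝ := Δ 0 with hp
  set q : ℝ := Δ 1 with hq
  have hD : p ^ 2 + q ^ 2 ≠ 0 := by
    intro h0
    have hp0 : p = 0 := by nlinarith [sq_nonneg p, sq_nonneg q]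
    have hq0 : q = 0 := by nlinarith [sq_nonneg p, sq_nonneg q]
    apply hΔ
    ext i; fin_cases i <;> simp [hor, e3, ← hp, ← hq, hp0, hq0]
  refine ⟨(d 0 * p + d 1 * q) / (p ^ 2 + q ^ 2), (d 1 * p - d 0 * q) / (p ^ 2 + q ^ 2), ?_⟩
  ext i; fin_cases i
  · simp [rotZ, hor, e3, ← hp, ← hq]
    field_simp
    ring
  · simp [rotZ, hor, e3, ← hp, ← hq]
    field_simp
    ring
  · simp [rotZ, hor, e3, hd]

end Summit.NavierStokesRegularity.NavierStokesRegularity.Theorems.ScenarioCensus.RowA8HonestCell
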